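import Mathlib.MeasureTheory.Measure.Lebesgue.EqHaar
import Mathlib.Analysis.SpecialFunctions.Integrability.Basic
import Mathlib.LinearAlgebra.AffineSpace.Midpoint
import Literature.Analysis.FunctionSpaces.SobolevImbeddingSup
import HarnessLib

/-!
# Morrey's inequality for `C¹` maps: mean oscillation, Hölder and sup bounds

Trunk: Sobolev (`Literature/Analysis/FunctionSpaces`). Proved results (no named facts), the
`C¹` half of Morrey's embedding `W^{1,p}(ℝⁿ) ⊂ C^{0,1-n/p}(ℝⁿ)` for `p > n`
(L. C. Evans, *Partial Differential Equations*, 2nd ed. (2010), §5.6.2, Theorem 4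
"Morrey's inequality": `‖u‖_{C^{0,γ}(ℝⁿ)} ≤ C ‖u‖_{W^{1,p}(ℝⁿ)}` for all `u ∈ C¹(ℝⁿ)`,
`γ = 1 - n/p`; R. A. Adams, *Sobolev Spaces* (1975), Lemma 5.17 and Thm. 5.4 Part II Case C').
On a real normed space `E` of dimension `n` with an additive Haar measure `μ`, for `1 ≤ p`,
`n < p` and every `C¹` map `h : E → F` into a complete real normed space:

* `lintegral_ball_enorm_sub_center_le` — the **mean-oscillation estimate**
  `∫_{B(x,r)} ‖h z - h x‖ dμ ≤ K r μ(B_r)^{1-1/p} ‖Dh‖_{L^p(μ)}` (Adams, proof of Lemma 5.17,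
  the chain of inequalities ending in (29); Evans, proof of Theorem 4, Step 1);
* `morrey_holder` — the **Hölder estimate** `‖h x - h y‖ ≤ C ‖Dh‖_{L^p} ‖x - y‖^{1-n/p}`
  (Adams, proof of Lemma 5.17, (28) with the two lines after (29); Evans, Theorem 4, Step 3);
* `morrey_sup` — the **sup estimate** `‖h x‖ ≤ C (‖h‖_{L^p} + ‖Dh‖_{L^p})`
  (Adams, Lemma 5.15, (25), case `m = 1`; Evans, Theorem 4, Step 2),

all constants being finite `ℝ≥0∞` numbers depending only on `E, μ, p`. The passage to
`u ∈ W^{1,p}` (Evans, Theorem 5 / Adams, Thm. 5.4 Part II Case C') is done by mollification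
(`Mollification`) in `SobolevTraceProofs` (`Literature.Analysis.FunctionSpaces.morrey_embedding_holds`).

## Proof

As printed in Adams, proof of Lemma 5.17 (segment form):
`h(z) - h(x) = ∫₀¹ Dh(x + t(z-x))(z-x) dt`;
integrate over `z ∈ B(x,r)`, substitute `w = x + t(z-x)` (Jacobian `t⁻ⁿ`,
`Measure.map_addHaar_smul`), apply Hölder on `B(x,tr)` and use `∫₀¹ t^{-n/p} dt < ∞`; this is
the argument of `Literature.Analysis.FunctionSpaces.morrey_pointwise` (`SobolevImbeddingSup`) run for the difference
`h z - h x` and a general radius, at the centre `x = 0`, followed by a translation. The Hölder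
estimate averages the mean-oscillation estimate for `x` and for `y` over the ball of radius
`r/2 = ‖x-y‖/2` about the midpoint, contained in `B(x,r) ∩ B(y,r)` (Evans, Step 3); the sup
estimate is `Literature.Analysis.FunctionSpaces.morrey_pointwise` after a translation plus Hölder on the unit ball.

## Mathlib search

Mathlib (this pin) has no Morrey inequality (`lean search 'Morrey'`: only this library's
`Literature.Analysis.FunctionSpaces.morrey_pointwise`); it provides the ingredients used here (`Measure.map_addHaar_smul`,
`Measure.addHaar_ball_of_pos`, `eLpNorm_le_eLpNorm_mul_rpow_measure_univ`,
`lintegral_add_right_eq_self`).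

## References

* L. C. Evans, *Partial Differential Equations*, 2nd ed., AMS GSM 19 (2010), §5.6.2,
  Theorems 4–5.
* R. A. Adams, *Sobolev Spaces*, Academic Press (1975), Lemmas 5.15, 5.17, Thm. 5.4.
-/

noncomputable section

open MeasureTheory Metric Set Filter Topology Module
open scoped ENNReal NNReal ContDiff

namespace Literature.Analysis.FunctionSpaces

variable {E : Type*} [NormedAddCommGroup E] [NormedSpace ℝ E]
variable {F : Type*} [NormedAddCommGroup F] [NormedSpace ℝ F]

/-- Integration along the segment `[0, z]`, difference form: for a `C¹` map `h`,
`‖h z - h 0‖ ≤ ∫₀¹ ‖Dh(t z)‖ ‖z‖ dt` (in `ℝ≥0∞`). [folklore] -/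
theorem enorm_sub_apply_zero_le_lintegral_fderiv_segment [CompleteSpace F] {h : E → F}
    (hh : ContDiff ℝ 1 h) (z : E) :
    ‖h z - h 0‖ₑ ≤ ∫⁻ t in Ioc (0 : ℝ) 1, ‖fderiv ℝ h (t • z)‖ₑ * ‖z‖ₑ := by
  have h1 := enorm_apply_zero_le_add_lintegral_fderiv_segment
    (hh.sub (contDiff_const (c := h z))) z
  simp only [sub_self, enorm_zero, zero_add, fderiv_sub_const] at h1
  rwa [enorm_sub_rev]

section Morrey

variable [MeasurableSpace E] [BorelSpace E] [FiniteDimensional ℝ E] (μ : Measure E)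
  [μ.IsAddHaarMeasure]

omit [NormedSpace ℝ E] [FiniteDimensional ℝ E] in
/-- Translating a set integral over a ball to the ball about the origin (translation
invariance of Haar measure). [folklore] -/
theorem setLIntegral_ball_eq_comp_add_right (G : E → ℝ≥0∞) (x : E) (r : ℝ) :
    ∫⁻ z in ball x r, G z ∂μ = ∫⁻ z in ball (0 : E) r, G (z + x) ∂μ := by
  rw [← lintegral_indicator measurableSet_ball, ← lintegral_indicator measurableSet_ball,
    ← lintegral_add_right_eq_self (μ := μ) ((ball x r).indicator G) x]
  refine lintegral_congr fun z => ?_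
  have hmem : z + x ∈ ball x r ↔ z ∈ ball (0 : E) r := by
    rw [mem_ball_iff_norm, mem_ball_zero_iff, add_sub_cancel_right]
  by_cases hz : z ∈ ball (0 : E) r
  · rw [indicator_of_mem hz, indicator_of_mem (hmem.2 hz)]
  · rw [indicator_of_notMem hz, indicator_of_notMem fun h' => hz (hmem.1 h')]

/-- **Mean-oscillation estimate at the origin** (Adams, *Sobolev Spaces* (1975), proof of
Lemma 5.17, the estimate leading to (29), for balls instead of cubes; Evans, *PDE*, §5.6.2,
proof of Theorem 4, Step 1): for `1 ≤ p`, `n = dim E < p` there is a finite `K` (namely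
`∫₀¹ t^{-n/p} dt`) with `∫_{B(0,r)} ‖h z - h 0‖ dμ ≤ K r μ(B(0,r))^{1-1/p} ‖Dh‖_{L^p(μ)}` for
every `C¹` map `h` and every `r > 0`. [cite: Adams1975, Lemma 5.17 (proof, (28)–(29))] -/
theorem lintegral_ball_enorm_sub_apply_zero_le [CompleteSpace F] {p : ℝ≥0} (hp1 : 1 ≤ p)
    (hp : (finrank ℝ E : ℝ) < p) :
    ∃ K : ℝ≥0∞, K < ⊤ ∧ ∀ ⦃h : E → F⦄, ContDiff ℝ 1 h → ∀ ⦃r : ℝ⦄, 0 < r →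
      ∫⁻ z in ball (0 : E) r, ‖h z - h 0‖ₑ ∂μ ≤
        K * ENNReal.ofReal r * μ (ball (0 : E) r) ^ (1 - (p : ℝ)⁻¹) *
          eLpNorm (fderiv ℝ h) p μ := by
  refine ⟨∫⁻ t in Ioc (0 : ℝ) 1, ENNReal.ofReal ((t ^ finrank ℝ E)⁻¹ *
      (t ^ finrank ℝ E) ^ (1 - (p : ℝ)⁻¹)), lintegral_morrey_weight_lt_top hp1 hp,
    fun h hh r hr => ?_⟩
  set B := ball (0 : E) r with hB
  set n := finrank ℝ E
  set a : ℝ := 1 - (p : ℝ)⁻¹ with ha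
  have ha0 : 0 ≤ a := by
    rw [ha, sub_nonneg]; exact inv_le_one_of_one_le₀ (by exact_mod_cast hp1)
  set N := eLpNorm (fderiv ℝ h) p μ
  set Kw := ∫⁻ t in Ioc (0 : ℝ) 1, ENNReal.ofReal ((t ^ n)⁻¹ * (t ^ n) ^ a)
  have hDcont : Continuous (fderiv ℝ h) := hh.continuous_fderiv one_ne_zero
  have hmeas2 : Measurable fun q : E × ℝ => ‖fderiv ℝ h (q.2 • q.1)‖ₑ :=
    (hDcont.comp (continuous_snd.smul continuous_fst)).enorm.measurable
  -- Step 1: integrate the segment inequality over `B`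
  have h1 : ∫⁻ z in B, ‖h z - h 0‖ₑ ∂μ ≤ ENNReal.ofReal r *
      ∫⁻ z in B, ∫⁻ t in Ioc (0 : ℝ) 1, ‖fderiv ℝ h (t • z)‖ₑ ∂volume ∂μ := by
    calc ∫⁻ z in B, ‖h z - h 0‖ₑ ∂μ
        ≤ ∫⁻ z in B, (∫⁻ t in Ioc (0 : ℝ) 1, ‖fderiv ℝ h (t • z)‖ₑ ∂volume) *
            ENNReal.ofReal r ∂μ := by
          refine setLIntegral_mono' measurableSet_ball fun z hz => ?_
          refine (enorm_sub_apply_zero_le_lintegral_fderiv_segment hh z).trans ?_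
          have hz1 : ‖z‖ₑ ≤ ENNReal.ofReal r := by
            rw [← ofReal_norm]; exact ENNReal.ofReal_le_ofReal (mem_ball_zero_iff.1 hz).le
          have hmz : Measurable fun t : ℝ => ‖fderiv ℝ h (t • z)‖ₑ :=
            (hDcont.comp (continuous_id.smul continuous_const)).enorm.measurable
          calc ∫⁻ t in Ioc (0 : ℝ) 1, ‖fderiv ℝ h (t • z)‖ₑ * ‖z‖ₑ
              ≤ ∫⁻ t in Ioc (0 : ℝ) 1, ‖fderiv ℝ h (t • z)‖ₑ * ENNReal.ofReal r :=
                lintegral_mono fun t => by gcongr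
            _ = (∫⁻ t in Ioc (0 : ℝ) 1, ‖fderiv ℝ h (t • z)‖ₑ) * ENNReal.ofReal r :=
                lintegral_mul_const _ hmz
      _ = ENNReal.ofReal r * ∫⁻ z in B, ∫⁻ t in Ioc (0 : ℝ) 1, ‖fderiv ℝ h (t • z)‖ₑ
            ∂volume ∂μ := by
          have hm : Measurable fun z : E => ∫⁻ t in Ioc (0 : ℝ) 1, ‖fderiv ℝ h (t • z)‖ₑ :=
            hmeas2.lintegral_prod_right'
          rw [lintegral_mul_const _ hm, mul_comm]
  -- Step 2: Tonelli
  have h2 : ∫⁻ z in B, ∫⁻ t in Ioc (0 : ℝ) 1, ‖fderiv ℝ h (t • z)‖ₑ ∂volume ∂μ =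
      ∫⁻ t in Ioc (0 : ℝ) 1, ∫⁻ z in B, ‖fderiv ℝ h (t • z)‖ₑ ∂μ ∂volume :=
    lintegral_lintegral_swap hmeas2.aemeasurable
  -- Step 3: change of variables + Hölder for fixed `t ∈ (0, 1]`
  have h3 : ∀ t ∈ Ioc (0 : ℝ) 1, ∫⁻ z in B, ‖fderiv ℝ h (t • z)‖ₑ ∂μ ≤
      N * μ B ^ a * ENNReal.ofReal ((t ^ n)⁻¹ * (t ^ n) ^ a) := by
    intro t ht
    have ht0 : 0 < t := ht.1
    set G : E → ℝ≥0∞ := (ball (0 : E) (t * r)).indicator fun w => ‖fderiv ℝ h w‖ₑ with hG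
    have hGm : Measurable G :=
      (continuous_enorm.comp hDcont).measurable.indicator measurableSet_ball
    have hmem : ∀ z : E, t • z ∈ ball (0 : E) (t * r) ↔ z ∈ B := by
      intro z
      rw [mem_ball_zero_iff, hB, mem_ball_zero_iff, norm_smul, Real.norm_of_nonneg ht0.le]
      exact mul_lt_mul_iff_right₀ ht0
    have hHolder : ∫⁻ w in ball (0 : E) (t * r), ‖fderiv ℝ h w‖ₑ ∂μ ≤
        N * μ (ball (0 : E) (t * r)) ^ a := by
      calc ∫⁻ w in ball (0 : E) (t * r), ‖fderiv ℝ h w‖ₑ ∂μ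
          = eLpNorm (fderiv ℝ h) 1 (μ.restrict (ball (0 : E) (t * r))) :=
            eLpNorm_one_eq_lintegral_enorm.symm
        _ ≤ eLpNorm (fderiv ℝ h) p (μ.restrict (ball (0 : E) (t * r))) *
              (μ.restrict (ball (0 : E) (t * r))) univ ^
                (1 / (1 : ℝ≥0∞).toReal - 1 / ((p : ℝ≥0∞)).toReal) :=
            eLpNorm_le_eLpNorm_mul_rpow_measure_univ (by exact_mod_cast hp1)
              hDcont.aestronglyMeasurable
        _ ≤ N * μ (ball (0 : E) (t * r)) ^ a := by
            rw [Measure.restrict_apply_univ]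
            have hexp : 1 / (1 : ℝ≥0∞).toReal - 1 / ((p : ℝ≥0∞)).toReal = a := by
              simp [ha]
            rw [hexp]
            gcongr
            exact eLpNorm_restrict_le _ _ _ _
    calc ∫⁻ z in B, ‖fderiv ℝ h (t • z)‖ₑ ∂μ
        = ∫⁻ z, B.indicator (fun z => ‖fderiv ℝ h (t • z)‖ₑ) z ∂μ :=
          (lintegral_indicator measurableSet_ball _).symm
      _ = ∫⁻ z, G (t • z) ∂μ := by
          refine lintegral_congr fun z => ?_
          by_cases hz : z ∈ B
          · rw [indicator_of_mem hz, hG, indicator_of_mem ((hmem z).2 hz)]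
          · rw [indicator_of_notMem hz, hG, indicator_of_notMem (fun h' => hz ((hmem z).1 h'))]
      _ = ∫⁻ w, G w ∂(Measure.map (fun z : E => t • z) μ) :=
          (lintegral_map hGm (measurable_const_smul t)).symm
      _ = ENNReal.ofReal (|(t ^ n)⁻¹|) * ∫⁻ w in ball (0 : E) (t * r), ‖fderiv ℝ h w‖ₑ ∂μ := by
          rw [Measure.map_addHaar_smul μ ht0.ne', lintegral_smul_measure, hG,
            lintegral_indicator measurableSet_ball, smul_eq_mul]
      _ ≤ ENNReal.ofReal ((t ^ n)⁻¹) * (N * μ (ball (0 : E) (t * r)) ^ a) := by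
          rw [abs_of_nonneg (by positivity)]
          gcongr
      _ = N * μ B ^ a * ENNReal.ofReal ((t ^ n)⁻¹ * (t ^ n) ^ a) := by
          rw [hB, Measure.addHaar_ball_mul_of_pos μ (0 : E) ht0 r,
            ENNReal.mul_rpow_of_nonneg _ _ ha0, ENNReal.ofReal_rpow_of_pos (pow_pos ht0 n),
            ENNReal.ofReal_mul (inv_nonneg.2 (pow_nonneg ht0.le n))]
          ring
  -- Step 4: integrate in `t`
  have h4 : ∫⁻ t in Ioc (0 : ℝ) 1, ∫⁻ z in B, ‖fderiv ℝ h (t • z)‖ₑ ∂μ ∂volume ≤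
      μ B ^ a * Kw * N := by
    calc ∫⁻ t in Ioc (0 : ℝ) 1, ∫⁻ z in B, ‖fderiv ℝ h (t • z)‖ₑ ∂μ ∂volume
        ≤ ∫⁻ t in Ioc (0 : ℝ) 1, N * μ B ^ a * ENNReal.ofReal ((t ^ n)⁻¹ * (t ^ n) ^ a)
            ∂volume := setLIntegral_mono' measurableSet_Ioc h3
      _ = N * μ B ^ a * Kw := by
          refine lintegral_const_mul _ ?_
          refine Measurable.ennreal_ofReal ?_
          exact ((measurable_id.pow_const n).inv).mul ((measurable_id.pow_const n).pow_const a)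
      _ = _ := by ring
  calc ∫⁻ z in B, ‖h z - h 0‖ₑ ∂μ
      ≤ ENNReal.ofReal r * ∫⁻ z in B, ∫⁻ t in Ioc (0 : ℝ) 1, ‖fderiv ℝ h (t • z)‖ₑ ∂volume ∂μ :=
        h1
    _ ≤ ENNReal.ofReal r * (μ B ^ a * Kw * N) := by rw [h2]; gcongr
    _ = Kw * ENNReal.ofReal r * μ B ^ a * N := by ring

/-- **Mean-oscillation estimate on balls** (Adams, *Sobolev Spaces* (1975), proof of
Lemma 5.17, the estimate leading to (29); Evans, *PDE*, §5.6.2, proof of Theorem 4, Step 1: the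
inequality `⨍_{B(x,r)} |u(y) - u(x)| dy ≤ C ∫_{B(x,r)} |Du(y)| / |y-x|^{n-1} dy` combined with
Hölder): for `1 ≤ p`, `n = dim E < p` there is a finite `K` such that
`∫_{B(x,r)} ‖h z - h x‖ dμ ≤ K r μ(B(0,r))^{1-1/p} ‖Dh‖_{L^p(μ)}` for every `C¹` map `h`, every
centre `x` and radius `r > 0`. From the origin case by translation invariance of `μ`. [cite: Adams1975, Lemma 5.17 (proof, (28)–(29))] -/
theorem lintegral_ball_enorm_sub_center_le [CompleteSpace F] {p : ℝ≥0} (hp1 : 1 ≤ p)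
    (hp : (finrank ℝ E : ℝ) < p) :
    ∃ K : ℝ≥0∞, K < ⊤ ∧ ∀ ⦃h : E → F⦄, ContDiff ℝ 1 h → ∀ (x : E) ⦃r : ℝ⦄, 0 < r →
      ∫⁻ z in ball x r, ‖h z - h x‖ₑ ∂μ ≤
        K * ENNReal.ofReal r * μ (ball (0 : E) r) ^ (1 - (p : ℝ)⁻¹) *
          eLpNorm (fderiv ℝ h) p μ := by
  obtain ⟨K, hK, hmain⟩ := lintegral_ball_enorm_sub_apply_zero_le μ (F := F) hp1 hp
  refine ⟨K, hK, fun h hh x r hr => ?_⟩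
  have hp0 : (p : ℝ≥0∞) ≠ 0 := by
    have : (0 : ℝ≥0) < p := lt_of_lt_of_le zero_lt_one hp1
    exact_mod_cast this.ne'
  set h' : E → F := fun y => h (y + x) with hh'
  have hh'c : ContDiff ℝ 1 h' := hh.comp (contDiff_id.add contDiff_const)
  have hD : eLpNorm (fderiv ℝ h') p μ = eLpNorm (fderiv ℝ h) p μ := by
    have : fderiv ℝ h' = fun y => fderiv ℝ h (y + x) := by
      ext1 y; exact fderiv_comp_add_right x
    rw [this]
    exact eLpNorm_comp_add_right μ (fderiv ℝ h) x hp0 ENNReal.coe_ne_top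
  calc ∫⁻ z in ball x r, ‖h z - h x‖ₑ ∂μ = ∫⁻ z in ball (0 : E) r, ‖h' z - h' 0‖ₑ ∂μ := by
        rw [setLIntegral_ball_eq_comp_add_right μ (fun z => ‖h z - h x‖ₑ) x r]
        simp only [hh', zero_add]
    _ ≤ K * ENNReal.ofReal r * μ (ball (0 : E) r) ^ (1 - (p : ℝ)⁻¹) *
          eLpNorm (fderiv ℝ h') p μ := hmain hh'c hr
    _ = _ := by rw [hD]

/-- **Morrey's Hölder estimate for `C¹` maps** (Evans, *PDE*, 2nd ed., §5.6.2, Theorem 4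
(Morrey's inequality), proof, Step 3: `|u(x) - u(y)| ≤ C r^{1-n/p} ‖Du‖_{L^p}`, `r = |x-y|`;
Adams, *Sobolev Spaces* (1975), proof of Lemma 5.17, (28)–(29) and the display after (29):
`|u(x)-u(y)| ≤ 2K₄|x-y|^{1-(n/p)} ‖grad u‖_{0,p,Ω}`): for `1 ≤ p`, `n = dim E < p` there is a
finite constant `C` (depending only
on `E, μ, p`) such that every `C¹` map `h : E → F` satisfies
`‖h x - h y‖ ≤ C ‖Dh‖_{L^p(μ)} ‖x - y‖^{1-n/p}` for all `x, y` (the right side may be `∞`).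
Proof as in Evans, Step 3: average the mean-oscillation estimates for `x` and for `y` over the
ball of radius `r/2` about the midpoint, which lies in `B(x,r) ∩ B(y,r)`. [cite: Adams1975, Lemma 5.17 (proof, (28)–(29))] [cite: Evans2010, §5.6.2 Theorem 4 (proof, Step 3)] -/
theorem morrey_holder [CompleteSpace F] {p : ℝ≥0} (hp1 : 1 ≤ p) (hp : (finrank ℝ E : ℝ) < p) :
    ∃ C : ℝ≥0∞, C < ⊤ ∧ ∀ ⦃h : E → F⦄, ContDiff ℝ 1 h → ∀ x y : E,
      ‖h x - h y‖ₑ ≤ C * eLpNorm (fderiv ℝ h) p μ *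
        edist x y ^ (1 - (finrank ℝ E : ℝ) / p) := by
  obtain ⟨K, hK, hosc⟩ := lintegral_ball_enorm_sub_center_le μ (F := F) hp1 hp
  set n := finrank ℝ E with hn
  set a : ℝ := 1 - (p : ℝ)⁻¹ with ha
  set V := μ (ball (0 : E) 1) with hV
  have hV0 : V ≠ 0 := (measure_ball_pos μ (0 : E) one_pos).ne'
  have hVtop : V ≠ ⊤ := measure_ball_lt_top.ne
  have hp0 : (0 : ℝ) < p := lt_of_lt_of_le zero_lt_one (by exact_mod_cast hp1)
  have ha0 : 0 ≤ a := by
    rw [ha, sub_nonneg]; exact inv_le_one_of_one_le₀ (by exact_mod_cast hp1)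
  refine ⟨2 ^ (n + 1) * K * V ^ a * V⁻¹, ?_, fun h hh x y => ?_⟩
  · refine ENNReal.mul_lt_top (ENNReal.mul_lt_top (ENNReal.mul_lt_top ?_ hK)
      (ENNReal.rpow_lt_top_of_nonneg ha0 hVtop)) (ENNReal.inv_lt_top.2 (pos_iff_ne_zero.2 hV0))
    exact ENNReal.pow_lt_top (by simp)
  set N := eLpNorm (fderiv ℝ h) p μ
  rcases eq_or_ne x y with rfl | hxy
  · simp
  set r : ℝ := dist x y with hr
  have hr0 : 0 < r := dist_pos.2 hxy
  -- the ball `W` of radius `r/2` about the midpoint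
  set m : E := midpoint ℝ x y with hm
  set W := ball m (r / 2) with hW
  have hWx : W ⊆ ball x r := by
    intro z hz
    rw [mem_ball] at hz ⊢
    calc dist z x ≤ dist z m + dist m x := dist_triangle _ _ _
      _ < r / 2 + r / 2 := by
          refine add_lt_add_of_lt_of_le hz ?_
          rw [hm, dist_comm, dist_left_midpoint, hr, Real.norm_of_nonneg (by norm_num)]
          exact le_of_eq (by ring)
      _ = r := by ring
  have hWy : W ⊆ ball y r := by
    intro z hz
    rw [mem_ball] at hz ⊢
    calc dist z y ≤ dist z m + dist m y := dist_triangle _ _ _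
      _ < r / 2 + r / 2 := by
          refine add_lt_add_of_lt_of_le hz ?_
          rw [hm, dist_comm, dist_right_midpoint, hr, Real.norm_of_nonneg (by norm_num)]
          exact le_of_eq (by ring)
      _ = r := by ring
  have hmeas : ∀ w : E, Measurable fun z => ‖h z - h w‖ₑ := fun w =>
    (hh.continuous.sub continuous_const).enorm.measurable
  -- averaging the two mean-oscillation estimates over `W`
  have key : μ W * ‖h x - h y‖ₑ ≤
      2 * (K * ENNReal.ofReal r * μ (ball (0 : E) r) ^ a * N) := by
    calc μ W * ‖h x - h y‖ₑ = ∫⁻ _ in W, ‖h x - h y‖ₑ ∂μ := by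
          rw [setLIntegral_const, mul_comm]
      _ ≤ ∫⁻ z in W, (‖h z - h x‖ₑ + ‖h z - h y‖ₑ) ∂μ := by
          refine lintegral_mono fun z => ?_
          calc ‖h x - h y‖ₑ = ‖(h x - h z) + (h z - h y)‖ₑ := by rw [sub_add_sub_cancel]
            _ ≤ ‖h x - h z‖ₑ + ‖h z - h y‖ₑ := enorm_add_le _ _
            _ = ‖h z - h x‖ₑ + ‖h z - h y‖ₑ := by rw [enorm_sub_rev]
      _ = (∫⁻ z in W, ‖h z - h x‖ₑ ∂μ) + ∫⁻ z in W, ‖h z - h y‖ₑ ∂μ :=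
          lintegral_add_left (hmeas x) _
      _ ≤ (∫⁻ z in ball x r, ‖h z - h x‖ₑ ∂μ) + ∫⁻ z in ball y r, ‖h z - h y‖ₑ ∂μ :=
          add_le_add (lintegral_mono_set hWx) (lintegral_mono_set hWy)
      _ ≤ K * ENNReal.ofReal r * μ (ball (0 : E) r) ^ a * N +
            K * ENNReal.ofReal r * μ (ball (0 : E) r) ^ a * N :=
          add_le_add (hosc hh x hr0) (hosc hh y hr0)
      _ = _ := by ring
  -- measures of the balls involved
  have hBr : μ (ball (0 : E) r) = ENNReal.ofReal (r ^ n) * V :=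
    Measure.addHaar_ball_of_pos μ (0 : E) hr0
  have hWm : μ W = ENNReal.ofReal ((r / 2) ^ n) * V := by
    rw [hW, Measure.addHaar_ball_center, Measure.addHaar_ball_of_pos μ (0 : E) (half_pos hr0)]
  have hW0 : μ W ≠ 0 := (measure_ball_pos μ m (half_pos hr0)).ne'
  have hWtop : μ W ≠ ⊤ := measure_ball_lt_top.ne
  -- the real-number identity behind the constants
  have hreal : ((r / 2) ^ n)⁻¹ * (2 * (r * (r ^ n) ^ a)) =
      2 ^ (n + 1) * r ^ (1 - (n : ℝ) / p) := by
    have h1 : ((r / 2) ^ n)⁻¹ = 2 ^ n * (r ^ n)⁻¹ := by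
      rw [div_pow, inv_div, div_eq_mul_inv]
    have h2 : (r ^ n) ^ a = r ^ n * r ^ (-((n : ℝ) / p)) := by
      rw [← Real.rpow_natCast r n, ← Real.rpow_mul hr0.le, ← Real.rpow_add hr0, ha]
      congr 1
      field_simp
      ring
    have h3 : r * r ^ (-((n : ℝ) / p)) = r ^ (1 - (n : ℝ) / p) := by
      conv_lhs => rw [← Real.rpow_one r]
      rw [← Real.rpow_mul hr0.le, ← Real.rpow_add hr0]
      congr 1
      ring
    rw [h1, h2, ← h3, pow_succ]
    field_simp
  have hedist : edist x y ^ (1 - (n : ℝ) / p) = ENNReal.ofReal (r ^ (1 - (n : ℝ) / p)) := by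
    rw [edist_dist, ← hr, ENNReal.ofReal_rpow_of_pos hr0]
  calc ‖h x - h y‖ₑ = (μ W)⁻¹ * (μ W * ‖h x - h y‖ₑ) := by
        rw [← mul_assoc, ENNReal.inv_mul_cancel hW0 hWtop, one_mul]
    _ ≤ (μ W)⁻¹ * (2 * (K * ENNReal.ofReal r * μ (ball (0 : E) r) ^ a * N)) := by gcongr
    _ = ENNReal.ofReal (((r / 2) ^ n)⁻¹ * (2 * (r * (r ^ n) ^ a))) *
          (V⁻¹ * V) * (K * V ^ a * V⁻¹ * N) := by
        rw [hWm, hBr, ENNReal.mul_inv (Or.inr hVtop) (Or.inr hV0),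
          ENNReal.mul_rpow_of_nonneg _ _ ha0, ← ENNReal.ofReal_inv_of_pos (by positivity),
          ENNReal.ofReal_rpow_of_pos (by positivity), ENNReal.ofReal_mul (by positivity),
          ENNReal.ofReal_mul (by positivity), ENNReal.ofReal_mul (by positivity),
          ENNReal.ofReal_ofNat, ENNReal.inv_mul_cancel hV0 hVtop]
        ring
    _ = 2 ^ (n + 1) * K * V ^ a * V⁻¹ * N * edist x y ^ (1 - (n : ℝ) / p) := by
        rw [hreal, hedist, ENNReal.inv_mul_cancel hV0 hVtop, ENNReal.ofReal_mul (by positivity),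
          ENNReal.ofReal_pow (by norm_num), ENNReal.ofReal_ofNat]
        ring

/-- **Morrey's sup estimate for `C¹` maps** (Evans, *PDE*, 2nd ed., §5.6.2, Theorem 4, proof,
Step 2: `sup |u| ≤ C ‖u‖_{W^{1,p}(ℝⁿ)}`; Adams, *Sobolev Spaces* (1975), (25) in
Lemma 5.15, case `m = 1`, `p > n`): for `1 ≤ p`, `n = dim E < p` there is a finite constant
`C` (depending only on `E, μ, p`) with `‖h x‖ ≤ C (‖h‖_{L^p(μ)} + ‖Dh‖_{L^p(μ)})` for every
`C¹` map `h : E → F` and every `x`. From `Literature.Analysis.FunctionSpaces.morrey_pointwise` by translation and Hölder on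
the unit ball. [cite: Adams1975, Lemma 5.15 ((25), case m = 1)] [cite: Evans2010, §5.6.2 Theorem 4 (proof, Step 2)] -/
theorem morrey_sup [CompleteSpace F] {p : ℝ≥0} (hp1 : 1 ≤ p) (hp : (finrank ℝ E : ℝ) < p) :
    ∃ C : ℝ≥0∞, C < ⊤ ∧ ∀ ⦃h : E → F⦄, ContDiff ℝ 1 h → ∀ x : E,
      ‖h x‖ₑ ≤ C * (eLpNorm h p μ + eLpNorm (fderiv ℝ h) p μ) := by
  obtain ⟨K, hK, hM⟩ := morrey_pointwise μ (F := F) hp1 hp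
  set a : ℝ := 1 - (p : ℝ)⁻¹ with ha
  set V := μ (ball (0 : E) 1) with hV
  have hV0 : V ≠ 0 := (measure_ball_pos μ (0 : E) one_pos).ne'
  have hVtop : V ≠ ⊤ := measure_ball_lt_top.ne
  have ha0 : 0 ≤ a := by
    rw [ha, sub_nonneg]; exact inv_le_one_of_one_le₀ (by exact_mod_cast hp1)
  have hp0 : (p : ℝ≥0∞) ≠ 0 := by
    have : (0 : ℝ≥0) < p := lt_of_lt_of_le zero_lt_one hp1
    exact_mod_cast this.ne'
  refine ⟨V⁻¹ * (V ^ a + K), ENNReal.mul_lt_top (ENNReal.inv_lt_top.2 (pos_iff_ne_zero.2 hV0))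
    (ENNReal.add_lt_top.2 ⟨ENNReal.rpow_lt_top_of_nonneg ha0 hVtop, hK⟩), fun h hh x => ?_⟩
  set h' : E → F := fun y => h (y + x) with hh'
  have hh'c : ContDiff ℝ 1 h' := hh.comp (contDiff_id.add contDiff_const)
  have h0 : h' 0 = h x := by simp [hh']
  have hL : eLpNorm h' p μ = eLpNorm h p μ := eLpNorm_comp_add_right μ h x hp0 ENNReal.coe_ne_top
  have hD : eLpNorm (fderiv ℝ h') p μ = eLpNorm (fderiv ℝ h) p μ := by
    have : fderiv ℝ h' = fun y => fderiv ℝ h (y + x) := by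
      ext1 y; exact fderiv_comp_add_right x
    rw [this]
    exact eLpNorm_comp_add_right μ (fderiv ℝ h) x hp0 ENNReal.coe_ne_top
  -- Hölder on the unit ball
  have hL1 : ∫⁻ z in ball (0 : E) 1, ‖h' z‖ₑ ∂μ ≤ eLpNorm h' p μ * V ^ a := by
    calc ∫⁻ z in ball (0 : E) 1, ‖h' z‖ₑ ∂μ
        = eLpNorm h' 1 (μ.restrict (ball (0 : E) 1)) := eLpNorm_one_eq_lintegral_enorm.symm
      _ ≤ eLpNorm h' p (μ.restrict (ball (0 : E) 1)) *
            (μ.restrict (ball (0 : E) 1)) univ ^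
              (1 / (1 : ℝ≥0∞).toReal - 1 / ((p : ℝ≥0∞)).toReal) :=
          eLpNorm_le_eLpNorm_mul_rpow_measure_univ (by exact_mod_cast hp1)
            hh'c.continuous.aestronglyMeasurable
      _ ≤ eLpNorm h' p μ * V ^ a := by
          rw [Measure.restrict_apply_univ]
          have hexp : 1 / (1 : ℝ≥0∞).toReal - 1 / ((p : ℝ≥0∞)).toReal = a := by simp [ha]
          rw [hexp]
          gcongr
          exact Measure.restrict_le_self
  have hmain := hM hh'c
  rw [h0, hL, hD] at *
  calc ‖h x‖ₑ = V⁻¹ * (V * ‖h x‖ₑ) := by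
        rw [← mul_assoc, ENNReal.inv_mul_cancel hV0 hVtop, one_mul]
    _ ≤ V⁻¹ * (eLpNorm h p μ * V ^ a + K * eLpNorm (fderiv ℝ h) p μ) := by
        gcongr
        exact hmain.trans (add_le_add hL1 le_rfl)
    _ ≤ V⁻¹ * ((V ^ a + K) * (eLpNorm h p μ + eLpNorm (fderiv ℝ h) p μ)) := by
        gcongr
        calc eLpNorm h p μ * V ^ a + K * eLpNorm (fderiv ℝ h) p μ
            = V ^ a * eLpNorm h p μ + K * eLpNorm (fderiv ℝ h) p μ := by ring
          _ ≤ (V ^ a * eLpNorm h p μ + V ^ a * eLpNorm (fderiv ℝ h) p μ) +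
              (K * eLpNorm h p μ + K * eLpNorm (fderiv ℝ h) p μ) :=
              add_le_add le_self_add le_add_self
          _ = _ := by ring
    _ = _ := by rw [mul_assoc]

end Morrey

end Literature.Analysis.FunctionSpaces
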